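import Summits.Ventures.YMGap.FlowData.RectTubeVacuumProjection
import HarnessLib

/-!
# Venture YMGap, track Y3 FLOW-DATA — the typed `e = 0` gap `m′` of the rectangular tube: the vacuum projection is
# `⟪φ₀, ·⟫ φ₀`, `‖T ∘ (P_0 − P_Ω)‖ < ‖T‖` (Jentzsch's gap), so `m′ > 0` whenever the excited trivial-flux space is not
# annihilated; and a two-state variational lower bound for `‖T ∘ (P_0 − P_Ω)‖` (theorems only; general compact group)

HONEST FRAMING: venture file of the cell `pub-ymgap` (QuantumFields programme), track Y3; companion THEOREMS for the
definitions of `FlowData/RectTubeVacuumProjection.lean` (`rectTubeMassGapPrime` = FLOW-PLAN O5 `m′`).  Finite rectangular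
torus, compact second-countable `G`, continuous unitary `ρ`, central involution `z`; no number, no row, nothing about
`L → ∞`, the continuum or a (thermodynamic) mass gap.  `m′ > 0` on a finite tube is the trivial finite-volume statement
(compact positivity-improving operator), typed so that the table's `m′` rows have a Lean home.

* `exists_rectVacuum_gap` — package: a unit, a.e. strictly positive, twist-invariant top eigenvector `φ₀` with
  `P_Ω = ⟪φ₀, ·⟫ φ₀` (`vacuumProjection_eq_of_simple` + Jentzsch simplicity) and a GAP `θ < ‖T‖` on `φ₀^⊥`
  (`Literature…IsPositivityImproving.exists_spectralGap`);
* `rectTubeExcitedNorm_lt_norm` — **`‖T ∘ (P_0 − P_Ω)‖ < ‖T‖`**; `rectTubeMassGapPrime_pos` — **`0 < m′`** as soon as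
  `0 < ‖T ∘ (P_0 − P_Ω)‖`;
* `rectTubeExcitedNorm_mul_ge_inner` — variational: `⟪ψ, Tψ⟫ ≤ ‖T ∘ (P_0 − P_Ω)‖ ‖ψ‖²` for `ψ` in the trivial-flux sector
  orthogonal to `φ₀`;
* **`rectTubeExcitedNorm_ge_half_of_two_states`** — the TWO-STATE bound: trivial-flux states `f₁, f₂` with `⟪φ₀, f₁⟫ ≠ 0`,
  `⟪f₁, T f₂⟫ = 0`, `⟪f_i, T f_i⟫ ≥ m ‖f_i‖²` (`m ≥ 0`) and `⟪f₂, T f₂⟫ > 0` give `m/2 ≤ ‖T ∘ (P_0 − P_Ω)‖` (combine them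
  into a vector orthogonal to the unknown `φ₀`; the `½` is the price of not knowing `⟪f₁, f₂⟫`).  Witnesses `f₁ = e^{−J mag/2}`,
  `f₂ = e^{−J mag/2}·(adjoint loop)` are supplied in `FlowData/RectTubeMassGapPrimeWindow.lean` (character chain: `FlowData/RectTubeCharacterLine.lean`).

References: M. Reed, B. Simon IV (1978) Thm. XIII.43–44 [cite: ReedSimonIV1978, §XIII.12]; G. 't Hooft, Nucl. Phys. B 153
(1979) 141 [cite: tHooft1979Flux]; I. Montvay, G. Münster (1994) §3.2.6 [cite: MontvayMunster1994, §3.2.6].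
-/

noncomputable section

open scoped BigOperators ENNReal InnerProductSpace
open MeasureTheory Filter Function
open Literature.MathematicalPhysics.QuantumFieldTheory Literature.Analysis.OperatorTheory

namespace Summit.Ventures.YMGap.FlowData

section Gap

variable {G : Type*} [Group G] [TopologicalSpace G] [IsTopologicalGroup G] [CompactSpace G]
  [MeasurableSpace G] [BorelSpace G] [SecondCountableTopology G] {n : ℕ} (ρ : G →* Matrix (Fin n) (Fin n) ℂ)
  (J : ℝ) {k : ℕ} {Ls : Fin k → ℕ} [∀ i, NeZero (Ls i)]

/-- **The vacuum package of the rectangular tube.**  For continuous unitary `ρ` and central `z`: a unit, a.e. strictly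
positive `φ₀` with `T φ₀ = ‖T‖ φ₀`, `C_s φ₀ = φ₀` for every twist, `P_0 φ₀ = φ₀`, the vacuum projection IS `⟪φ₀, ·⟫ φ₀`,
and `T` has a gap on `φ₀^⊥`: `‖T w‖ ≤ θ ‖w‖` (`⟪φ₀, w⟫ = 0`) for some `0 ≤ θ < ‖T‖`. [cite: ReedSimonIV1978, §XIII.12] -/
theorem exists_rectVacuum_gap (hρ : Continuous ρ) (hρu : ∀ g, ρ g ∈ Matrix.unitaryGroup (Fin n) ℂ) {z : G}
    (hz : z ∈ Subgroup.center G) :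
    ∃ φ₀ : Lp ℝ 2 (rectSliceMeasure G Ls), ‖φ₀‖ = 1 ∧ IsStrictlyPositiveFun φ₀ ∧
      rectTubeTransferOperator ρ J Ls φ₀ = ‖rectTubeTransferOperator ρ J Ls‖ • φ₀ ∧
      (∀ s : Fin k → ZMod 2, rectFluxTwistOp Ls z s φ₀ = φ₀) ∧
      rectTubeFluxProjection z Ls 0 φ₀ = φ₀ ∧
      (∀ ψ, rectTubeVacuumProjection ρ J Ls ψ = (@inner ℝ _ _ φ₀ ψ) • φ₀) ∧
      ∃ θ : ℝ, 0 ≤ θ ∧ θ < ‖rectTubeTransferOperator ρ J Ls‖ ∧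
        ∀ w : Lp ℝ 2 (rectSliceMeasure G Ls), @inner ℝ _ _ φ₀ w = 0 →
          ‖rectTubeTransferOperator ρ J Ls w‖ ≤ θ * ‖w‖ := by
  set T := rectTubeTransferOperator ρ J Ls with hT
  obtain ⟨φ₀, h1, hpos, heig, hsimple, hinv⟩ := exists_rectVacuum ρ J hρ hρu hz (Ls := Ls)
  obtain ⟨φ, hφ1, -, hφeig, -, θ, hθ0, hθ, hgap⟩ :=
    (isPositivityImproving_rectTubeTransferOperator J Ls hρ).exists_spectralGap
      (isSelfAdjoint_rectTubeTransferOperator J Ls hρ hρu) (isCompactOperator_rectTubeTransferOperator J Ls hρ)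
      (norm_pos_iff.1 (norm_rectTubeTransferOperator_pos J Ls hρ))
  -- `φ = c φ₀`, so `φ^⊥ ⊇ φ₀^⊥`
  have hφc : φ = (@inner ℝ _ _ φ₀ φ) • φ₀ := hsimple φ hφeig
  refine ⟨φ₀, h1, hpos, heig, hinv, ?_, fun ψ => ?_, θ, hθ0, hθ, fun w hw => hgap w ?_⟩
  · rw [rectTubeFluxProjection_apply_of_invariant z hinv, if_pos rfl]
  · exact vacuumProjection_eq_of_simple T h1 heig hsimple ψ
  · rw [hφc, real_inner_smul_left, hw, mul_zero]

/-- **Jentzsch's gap, operator form: `‖T ∘ (P_0 − P_Ω)‖ < ‖T‖`** on every rectangular tube (continuous unitary `ρ`,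
central involution `z`): the excited trivial-flux space lies in `φ₀^⊥`, where `T` is bounded by `θ < ‖T‖`.
[cite: ReedSimonIV1978, §XIII.12] -/
theorem rectTubeExcitedNorm_lt_norm (hρ : Continuous ρ) (hρu : ∀ g, ρ g ∈ Matrix.unitaryGroup (Fin n) ℂ) {z : G}
    (hz : z ∈ Subgroup.center G) (hzz : z * z = 1) :
    rectTubeExcitedNorm ρ z J Ls < ‖rectTubeTransferOperator ρ J Ls‖ := by
  obtain ⟨φ₀, h1, -, -, -, hP0, hvac, θ, hθ0, hθ, hgap⟩ := exists_rectVacuum_gap ρ J hρ hρu hz (Ls := Ls)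
  refine lt_of_le_of_lt ?_ hθ
  unfold rectTubeExcitedNorm excitedSectorNorm
  refine ContinuousLinearMap.opNorm_le_bound _ hθ0 fun ψ => ?_
  rw [ContinuousLinearMap.comp_apply]
  simp only [FunLike.coe_sub, Pi.sub_apply]
  rw [show fluxProjection (rectFluxTwistOp Ls z) 0 = rectTubeFluxProjection z Ls 0 from rfl,
    show vacuumProjection (rectTubeTransferOperator ρ J Ls) = rectTubeVacuumProjection ρ J Ls from rfl, hvac ψ]
  -- `w = P_0 ψ − ⟪φ₀, ψ⟫ φ₀ = P_0 (ψ − ⟪φ₀, ψ⟫ φ₀)` is orthogonal to `φ₀` and no longer than `ψ`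
  have hsa := isSelfAdjoint_rectTubeFluxProjection (Ls := Ls) z hzz 0
  have hinnerP : @inner ℝ _ _ φ₀ (rectTubeFluxProjection z Ls 0 ψ) = @inner ℝ _ _ φ₀ ψ := by
    have h := (ContinuousLinearMap.isSelfAdjoint_iff_isSymmetric.1 hsa) φ₀ ψ
    rw [ContinuousLinearMap.coe_coe, hP0] at h
    exact h.symm
  have hw0 : @inner ℝ _ _ φ₀ (rectTubeFluxProjection z Ls 0 ψ - (@inner ℝ _ _ φ₀ ψ) • φ₀) = 0 := by
    rw [inner_sub_right, hinnerP, real_inner_smul_right, real_inner_self_eq_norm_sq, h1, one_pow, mul_one, sub_self]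
  have hfactor : rectTubeFluxProjection z Ls 0 ψ - (@inner ℝ _ _ φ₀ ψ) • φ₀ =
      rectTubeFluxProjection z Ls 0 (ψ - (@inner ℝ _ _ φ₀ ψ) • φ₀) := by
    rw [map_sub, map_smul, hP0]
  have hnorm : ‖rectTubeFluxProjection z Ls 0 ψ - (@inner ℝ _ _ φ₀ ψ) • φ₀‖ ≤ ‖ψ‖ := by
    rw [hfactor]
    calc ‖rectTubeFluxProjection z Ls 0 (ψ - (@inner ℝ _ _ φ₀ ψ) • φ₀)‖
        ≤ ‖rectTubeFluxProjection z Ls 0‖ * ‖ψ - (@inner ℝ _ _ φ₀ ψ) • φ₀‖ := ContinuousLinearMap.le_opNorm _ _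
      _ ≤ 1 * ‖ψ‖ := mul_le_mul (norm_fluxProjection_le_one (fun s => norm_rectFluxTwistOp_le_one (Ls := Ls) z s) 0)
          (inner_sub_inner_smul_eq_zero_and_norm_le h1 ψ).2 (norm_nonneg _) zero_le_one
      _ = ‖ψ‖ := one_mul _
  calc ‖rectTubeTransferOperator ρ J Ls (rectTubeFluxProjection z Ls 0 ψ - (@inner ℝ _ _ φ₀ ψ) • φ₀)‖
      ≤ θ * ‖rectTubeFluxProjection z Ls 0 ψ - (@inner ℝ _ _ φ₀ ψ) • φ₀‖ := hgap _ hw0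
    _ ≤ θ * ‖ψ‖ := mul_le_mul_of_nonneg_left hnorm hθ0

/-- **`m′ > 0` whenever the excited trivial-flux space is not annihilated** (`0 < ‖T ∘ (P_0 − P_Ω)‖`):
`0 < rectTubeMassGapPrime`. [cite: ReedSimonIV1978, §XIII.12] -/
theorem rectTubeMassGapPrime_pos (hρ : Continuous ρ) (hρu : ∀ g, ρ g ∈ Matrix.unitaryGroup (Fin n) ℂ) {z : G}
    (hz : z ∈ Subgroup.center G) (hzz : z * z = 1) (hpos : 0 < rectTubeExcitedNorm ρ z J Ls) :
    0 < rectTubeMassGapPrime ρ z J Ls := by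
  rw [rectTubeMassGapPrime_eq]
  exact sub_pos.2 (Real.log_lt_log hpos (rectTubeExcitedNorm_lt_norm ρ J hρ hρu hz hzz))

omit [SecondCountableTopology G] in
/-- **Variational principle for the excited norm**: for `ψ` in the trivial-flux sector and orthogonal to the vacuum,
`⟪ψ, Tψ⟫ ≤ ‖T ∘ (P_0 − P_Ω)‖ · ‖ψ‖²`. [folklore] -/
theorem rectTubeExcitedNorm_mul_ge_inner {z : G} {φ₀ : Lp ℝ 2 (rectSliceMeasure G Ls)}
    (hvac : ∀ ψ, rectTubeVacuumProjection ρ J Ls ψ = (@inner ℝ _ _ φ₀ ψ) • φ₀)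
    {ψ : Lp ℝ 2 (rectSliceMeasure G Ls)} (hP0 : rectTubeFluxProjection z Ls 0 ψ = ψ) (horth : @inner ℝ _ _ φ₀ ψ = 0) :
    @inner ℝ _ _ ψ (rectTubeTransferOperator ρ J Ls ψ) ≤ rectTubeExcitedNorm ρ z J Ls * ‖ψ‖ ^ 2 := by
  set A := (rectTubeTransferOperator ρ J Ls).comp
    (fluxProjection (rectFluxTwistOp Ls z) 0 - vacuumProjection (rectTubeTransferOperator ρ J Ls)) with hA
  have hAψ : A ψ = rectTubeTransferOperator ρ J Ls ψ := by
    rw [hA, ContinuousLinearMap.comp_apply]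
    simp only [FunLike.coe_sub, Pi.sub_apply]
    rw [show fluxProjection (rectFluxTwistOp Ls z) 0 = rectTubeFluxProjection z Ls 0 from rfl,
      show vacuumProjection (rectTubeTransferOperator ρ J Ls) = rectTubeVacuumProjection ρ J Ls from rfl, hvac ψ, hP0,
      horth, zero_smul, sub_zero]
  unfold rectTubeExcitedNorm excitedSectorNorm
  rw [← hA, ← hAψ]
  calc @inner ℝ _ _ ψ (A ψ) ≤ ‖ψ‖ * ‖A ψ‖ := real_inner_le_norm _ _
    _ ≤ ‖ψ‖ * (‖A‖ * ‖ψ‖) := mul_le_mul_of_nonneg_left (A.le_opNorm ψ) (norm_nonneg _)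
    _ = ‖A‖ * ‖ψ‖ ^ 2 := by ring

/-- **The two-state bound.**  Let `f₁, f₂` lie in the trivial-flux sector with `⟪φ₀, f₁⟫ ≠ 0` (e.g. `f₁ > 0`),
`⟪f₁, T f₂⟫ = 0`, `⟪f_i, T f_i⟫ ≥ m ‖f_i‖²` (`m ≥ 0`) and `⟪f₂, T f₂⟫ > 0`.  Then `m / 2 ≤ ‖T ∘ (P_0 − P_Ω)‖`: the
combination `ψ = f₂ − (⟪φ₀,f₂⟫/⟪φ₀,f₁⟫) f₁` is orthogonal to the (unknown) vacuum, `⟪ψ, Tψ⟫ = ⟪f₂,Tf₂⟫ + α²⟪f₁,Tf₁⟫` and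
`‖ψ‖² ≤ 2(‖f₂‖² + α²‖f₁‖²)`. [folklore] -/
theorem rectTubeExcitedNorm_ge_half_of_two_states (hρ : Continuous ρ) (hρu : ∀ g, ρ g ∈ Matrix.unitaryGroup (Fin n) ℂ)
    {z : G} {φ₀ : Lp ℝ 2 (rectSliceMeasure G Ls)}
    (hvac : ∀ ψ, rectTubeVacuumProjection ρ J Ls ψ = (@inner ℝ _ _ φ₀ ψ) • φ₀)
    {f₁ f₂ : Lp ℝ 2 (rectSliceMeasure G Ls)} (hf₁ : rectTubeFluxProjection z Ls 0 f₁ = f₁)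
    (hf₂ : rectTubeFluxProjection z Ls 0 f₂ = f₂) (hφf₁ : @inner ℝ _ _ φ₀ f₁ ≠ 0)
    (hcross : @inner ℝ _ _ f₁ (rectTubeTransferOperator ρ J Ls f₂) = 0) {m : ℝ} (hm : 0 ≤ m)
    (hA₁ : m * ‖f₁‖ ^ 2 ≤ @inner ℝ _ _ f₁ (rectTubeTransferOperator ρ J Ls f₁))
    (hA₂ : m * ‖f₂‖ ^ 2 ≤ @inner ℝ _ _ f₂ (rectTubeTransferOperator ρ J Ls f₂))
    (hA₂pos : 0 < @inner ℝ _ _ f₂ (rectTubeTransferOperator ρ J Ls f₂)) :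
    m / 2 ≤ rectTubeExcitedNorm ρ z J Ls := by
  set T := rectTubeTransferOperator ρ J Ls with hT
  set α : ℝ := @inner ℝ _ _ φ₀ f₂ / @inner ℝ _ _ φ₀ f₁ with hα
  set ψ : Lp ℝ 2 (rectSliceMeasure G Ls) := f₂ - α • f₁ with hψ
  have hsymm := ContinuousLinearMap.isSelfAdjoint_iff_isSymmetric.1 (isSelfAdjoint_rectTubeTransferOperator J Ls hρ hρu)
  have hcross' : @inner ℝ _ _ f₂ (T f₁) = 0 := by
    have h := hsymm f₁ f₂
    rw [ContinuousLinearMap.coe_coe] at h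
    calc @inner ℝ _ _ f₂ (T f₁) = @inner ℝ _ _ (T f₁) f₂ := real_inner_comm _ _
      _ = @inner ℝ _ _ f₁ (T f₂) := h
      _ = 0 := hcross
  have hP0 : rectTubeFluxProjection z Ls 0 ψ = ψ := by
    rw [hψ, map_sub, map_smul, hf₁, hf₂]
  have horth : @inner ℝ _ _ φ₀ ψ = 0 := by
    rw [hψ, inner_sub_right, real_inner_smul_right, hα, div_mul_cancel₀ _ hφf₁, sub_self]
  -- `⟪ψ, Tψ⟫ = A₂ + α² A₁`
  have hform : @inner ℝ _ _ ψ (T ψ) = @inner ℝ _ _ f₂ (T f₂) + α ^ 2 * @inner ℝ _ _ f₁ (T f₁) := by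
    rw [hψ, map_sub, map_smul, inner_sub_left, inner_sub_right, inner_sub_right, real_inner_smul_left,
      real_inner_smul_left, real_inner_smul_right, real_inner_smul_right, hcross, hcross']
    ring
  -- `‖ψ‖² ≤ 2 (‖f₂‖² + α² ‖f₁‖²)`
  have hnormψ : ‖ψ‖ ^ 2 ≤ 2 * (‖f₂‖ ^ 2 + α ^ 2 * ‖f₁‖ ^ 2) := by
    have h1 : ‖ψ‖ ≤ ‖f₂‖ + ‖α • f₁‖ := norm_sub_le _ _
    rw [norm_smul, Real.norm_eq_abs] at h1
    have h2 : 0 ≤ ‖f₂‖ := norm_nonneg _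
    have h3 : 0 ≤ |α| * ‖f₁‖ := mul_nonneg (abs_nonneg _) (norm_nonneg _)
    have h4 : ‖ψ‖ ^ 2 ≤ (‖f₂‖ + |α| * ‖f₁‖) ^ 2 := pow_le_pow_left₀ (norm_nonneg _) h1 2
    have h5 : (‖f₂‖ + |α| * ‖f₁‖) ^ 2 ≤ 2 * (‖f₂‖ ^ 2 + (|α| * ‖f₁‖) ^ 2) := by
      nlinarith [sq_nonneg (‖f₂‖ - |α| * ‖f₁‖)]
    rw [mul_pow, sq_abs] at h5
    exact h4.trans h5
  -- variational principle and division
  have hvar := rectTubeExcitedNorm_mul_ge_inner ρ J (Ls := Ls) hvac hP0 horth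
  have hE0 : 0 ≤ rectTubeExcitedNorm ρ z J Ls := excitedSectorNorm_nonneg _ _
  have hψpos : 0 < @inner ℝ _ _ ψ (T ψ) := by
    rw [hform]
    have : 0 ≤ α ^ 2 * @inner ℝ _ _ f₁ (T f₁) :=
      mul_nonneg (sq_nonneg _) (le_trans (mul_nonneg hm (sq_nonneg _)) hA₁)
    linarith
  have hψne : 0 < ‖ψ‖ ^ 2 := by
    by_contra h
    have h0 : ‖ψ‖ ^ 2 = 0 := le_antisymm (not_lt.1 h) (sq_nonneg _)
    have := hvar
    rw [h0, mul_zero] at this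
    exact absurd this (not_le.2 hψpos)
  -- `m (‖f₂‖² + α²‖f₁‖²) ≤ ⟪ψ,Tψ⟫ ≤ E ‖ψ‖² ≤ 2E (‖f₂‖² + α²‖f₁‖²)`
  have hsum_pos : 0 < ‖f₂‖ ^ 2 + α ^ 2 * ‖f₁‖ ^ 2 := by
    have : 0 < 2 * (‖f₂‖ ^ 2 + α ^ 2 * ‖f₁‖ ^ 2) := lt_of_lt_of_le hψne hnormψ
    linarith
  have hlow : m * (‖f₂‖ ^ 2 + α ^ 2 * ‖f₁‖ ^ 2) ≤ @inner ℝ _ _ ψ (T ψ) := by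
    rw [hform]
    nlinarith [hA₁, hA₂, sq_nonneg α]
  have hup : @inner ℝ _ _ ψ (T ψ) ≤ rectTubeExcitedNorm ρ z J Ls * (2 * (‖f₂‖ ^ 2 + α ^ 2 * ‖f₁‖ ^ 2)) :=
    hvar.trans (mul_le_mul_of_nonneg_left hnormψ hE0)
  have h := hlow.trans hup
  -- divide by the positive quantity
  have : m ≤ 2 * rectTubeExcitedNorm ρ z J Ls := by
    have h' : m * (‖f₂‖ ^ 2 + α ^ 2 * ‖f₁‖ ^ 2) ≤ (2 * rectTubeExcitedNorm ρ z J Ls) * (‖f₂‖ ^ 2 + α ^ 2 * ‖f₁‖ ^ 2) := by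
      linarith
    exact le_of_mul_le_mul_right h' hsum_pos
  linarith

end Gap

end Summit.Ventures.YMGap.FlowData
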